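import Summits.CriticalPhenomena.PercolationContinuityZ3.Theorems.NearLinearTwoClusterDecay.Negative.FaceDecomposition
import Summits.CriticalPhenomena.PercolationContinuityZ3.Theorems.NearLinearTwoClusterDecay.Negative.FaceSymmetry
import Summits.CriticalPhenomena.PercolationContinuityZ3.Theorems.NearLinearTwoClusterDecay.Negative.AspectRenorm
import HarnessLib

/-!
# vdBvE's `E₁ ∩ F₂ ∩ F₃ ⊆ A₂` construction: a closed slab between two plate arms gives two distinct
# crossing clusters (vdBvE programme, assembly part I — geometry, locality, independence)

Negative-side structure for the crux `NearLinearTwoClusterDecay` (stmt-CriticalPhenomena-5785), line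
`critical-orange-peeling`, lead seat c2.  Bond percolation `P_p` on `ℤ³`; for `1 ≤ a ≤ b`, `h = a - 1`:

* `V(b,h)`  = an open vertical crossing of the slab box `Q = Λ(b) ∩ {|v₂| ≤ h}` (bottom layer to top
  layer, inside `Q`);  `E₁ = V(b,h)ᶜ` ("a closed barrier separates top from bottom");
* `F⁺(a,b)` = an open path inside the half-space `{v₂ ≥ a}` from the plate `[-a,a]²×{a}` to the plane
  `{v₂ = b}`;  `F⁻(a,b)` its mirror image;  their finite-volume shadows `F±_fin` (first exit from `Λ(b)`);
* `A₂(a,b)` = the crux's two-cluster event.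

Results: `BoundedAspectGeometry.subset_twoCluster` (`E₁ ∩ F⁺_fin ∩ F⁻_fin ⊆ A₂(a,b)` on lattice
configurations: the two arms start in `Λ(a)`, reach `∂ⁱⁿΛ(b)` inside `Λ(b)`, and an open path inside
`Λ(b)` joining them would cross the slab `Q` vertically — two level crossings,
`FaceDecomposition.exists_levelPath_of_gt_of_ge` / `…_of_lt_of_le`), locality of the three events in the
pairwise disjoint vertex regions `Q`, `Λ(b) ∩ {v₂ ≥ a}`, `Λ(b) ∩ {v₂ ≤ -a}` and their independence, and the
registered inequality

* `twoCluster_ge_barrier_mul_plate_sq` : `(1 - P_p(V(b, a-1))) · P_p(F⁺(a,b))² ≤ P_p(A₂(a,b))`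
  (`P(F⁻) = P(F⁺)` by `plate_reflection`).

[cite: VandenbergVanengelenburg2022, proof of Prop. 2 ("the event `A₂(8Mn, 8M²n)` contains `E₁ ∩ F₂ ∩ F₃`")]
-/

noncomputable section

namespace Summit.CriticalPhenomena.PercolationContinuityZ3.Theorems.NearLinearTwoClusterDecay.Negative

open MeasureTheory Filter Topology
open Literature.Probability.LatticeModels Literature.Probability.Percolation
open Literature.Probability.Percolation.DCT16
open Summit.CriticalPhenomena.PercolationContinuityZ3.Theorems.SubpolynomialBlocking.StubAnnulusCrossingRenorm

namespace BoundedAspectGeometry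

/-! ## §1 Membership bookkeeping for filtered boxes -/

/-- A point of the upper plate `[-a,a]²×{a}` lies in `Λ(a)`. -/
theorem mem_box_of_plate {a : ℕ} {x : Site 3} (h0 : |x 0| ≤ (a : ℤ)) (h1 : |x 1| ≤ (a : ℤ))
    (h2 : x 2 = (a : ℤ) ∨ x 2 = -(a : ℤ)) : x ∈ box 3 a := by
  rw [mem_box]
  intro i
  rw [abs_le] at h0 h1
  rcases (by decide : ∀ i : Fin 3, i = 0 ∨ i = 1 ∨ i = 2) i with rfl | rfl | rfl
  · exact h0
  · exact h1
  · rcases h2 with h2 | h2 <;> rw [h2] <;> omega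

/-- The coerced filtered box is the intersection of the predicate set with the coerced box. -/
theorem coe_filter_eq (b : ℕ) (P : Site 3 → Prop) [DecidablePred P] :
    (↑((box 3 b).filter P) : Set (Site 3)) = {v | P v} ∩ ↑(box 3 b) := by
  ext v; simp [and_comm]

/-- A site of `Λ(b)` with third coordinate `b` lies on the inner vertex boundary of `Λ(b)`. -/
theorem mem_innerBoundary_of_apply_two_eq {b : ℕ} {y : Site 3} (hy : y ∈ box 3 b) (h2 : y 2 = (b : ℤ)) :
    y ∈ innerBoundary (zdGraph 3) (box 3 b) := by
  rw [mem_innerBoundary_iff]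
  refine ⟨hy, y + Pi.single 2 1, ?_, ?_⟩
  · intro h
    have := ((mem_box.1 h) 2).2
    simp only [Pi.add_apply, Pi.single_eq_same] at this
    omega
  · rw [zdGraph_adj_iff]; exact ⟨2, Or.inl rfl⟩

/-- Mirror image: third coordinate `-b`. -/
theorem mem_innerBoundary_of_apply_two_eq_neg {b : ℕ} {y : Site 3} (hy : y ∈ box 3 b)
    (h2 : y 2 = -(b : ℤ)) : y ∈ innerBoundary (zdGraph 3) (box 3 b) := by
  rw [mem_innerBoundary_iff]
  refine ⟨hy, y - Pi.single 2 1, ?_, ?_⟩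
  · intro h
    have := ((mem_box.1 h) 2).1
    simp only [Pi.sub_apply, Pi.single_eq_same] at this
    omega
  · rw [zdGraph_adj_iff]; exact ⟨2, Or.inr (by simp)⟩

/-! ## §2 The finite-volume shadow of a plate arm (first exit from `Λ(b)`) -/

/-- **First exit of the upper plate arm.** On a lattice configuration, an open path inside the
half-space `{v₂ ≥ a}` from a plate point `x` (`|x₀|,|x₁| ≤ a ≤ b`, `x₂ = a`) to the plane `{v₂ = b}`
yields a point of `∂ⁱⁿΛ(b)` joined to `x` inside `Λ(b) ∩ {v₂ ≥ a}`. -/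
theorem exists_exit_upper {a b : ℕ} (hab : a ≤ b) {ω : BondConfig (Site 3)} (hω : ω ⊆ (zdGraph 3).edgeSet)
    {x y : Site 3} (h0 : |x 0| ≤ (a : ℤ)) (h1 : |x 1| ≤ (a : ℤ)) (h2 : x 2 = (a : ℤ)) (hy : y 2 = (b : ℤ))
    (hpath : ω ∈ openConnIn {v : Site 3 | (a : ℤ) ≤ v 2} x y) :
    ∃ w ∈ innerBoundary (zdGraph 3) (box 3 b),
      ω ∈ openConnIn (↑((box 3 b).filter (fun v => (a : ℤ) ≤ v 2)) : Set (Site 3)) x w := by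
  have hP := mem_openConnIn_iff_pathIn.1 hpath
  have hxb : x ∈ (↑(box 3 b) : Set (Site 3)) :=
    Finset.mem_coe.2 (box_mono (d := 3) hab (mem_box_of_plate h0 h1 (Or.inl h2)))
  rw [coe_filter_eq]
  rcases hP.exit_or (R := (↑(box 3 b) : Set (Site 3))) hxb with hin | ⟨c, e, hc, he, -, hce, hseg⟩
  · refine ⟨y, mem_innerBoundary_of_apply_two_eq (Finset.mem_coe.1 hin.right_mem.1) hy, ?_⟩
    exact mem_openConnIn_of_pathIn (hin.mono fun v hv => ⟨hv.2, hv.1⟩)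
  · refine ⟨c, mem_innerBoundary_iff.2 ⟨Finset.mem_coe.1 hc, e, fun h' => he (Finset.mem_coe.2 h'),
      adj_of_openGraph_adj hω hce⟩, ?_⟩
    exact mem_openConnIn_of_pathIn (hseg.mono fun v hv => ⟨hv.2, hv.1⟩)

/-- **First exit of the lower plate arm** (mirror image). -/
theorem exists_exit_lower {a b : ℕ} (hab : a ≤ b) {ω : BondConfig (Site 3)} (hω : ω ⊆ (zdGraph 3).edgeSet)
    {x y : Site 3} (h0 : |x 0| ≤ (a : ℤ)) (h1 : |x 1| ≤ (a : ℤ)) (h2 : x 2 = -(a : ℤ)) (hy : y 2 = -(b : ℤ))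
    (hpath : ω ∈ openConnIn {v : Site 3 | v 2 ≤ -(a : ℤ)} x y) :
    ∃ w ∈ innerBoundary (zdGraph 3) (box 3 b),
      ω ∈ openConnIn (↑((box 3 b).filter (fun v => v 2 ≤ -(a : ℤ))) : Set (Site 3)) x w := by
  have hP := mem_openConnIn_iff_pathIn.1 hpath
  have hxb : x ∈ (↑(box 3 b) : Set (Site 3)) :=
    Finset.mem_coe.2 (box_mono (d := 3) hab (mem_box_of_plate h0 h1 (Or.inr h2)))
  rw [coe_filter_eq]
  rcases hP.exit_or (R := (↑(box 3 b) : Set (Site 3))) hxb with hin | ⟨c, e, hc, he, -, hce, hseg⟩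
  · refine ⟨y, mem_innerBoundary_of_apply_two_eq_neg (Finset.mem_coe.1 hin.right_mem.1) hy, ?_⟩
    exact mem_openConnIn_of_pathIn (hin.mono fun v hv => ⟨hv.2, hv.1⟩)
  · refine ⟨c, mem_innerBoundary_iff.2 ⟨Finset.mem_coe.1 hc, e, fun h' => he (Finset.mem_coe.2 h'),
      adj_of_openGraph_adj hω hce⟩, ?_⟩
    exact mem_openConnIn_of_pathIn (hseg.mono fun v hv => ⟨hv.2, hv.1⟩)

/-! ## §3 The inclusion `E₁ ∩ F⁺_fin ∩ F⁻_fin ⊆ A₂(a,b)` -/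

/-- **A path inside `Λ(b)` from the level `a` down to the level `-a` crosses the slab
`Λ(b) ∩ {|v₂| ≤ a-1}` vertically** (two level crossings). -/
theorem slabCrossing_of_pathIn {a b : ℕ} (ha : 1 ≤ a) {ω : BondConfig (Site 3)} (hω : ω ⊆ (zdGraph 3).edgeSet)
    {x x' : Site 3} (hx : x 2 = (a : ℤ)) (hx' : x' 2 = -(a : ℤ))
    (hP : PathIn (openGraph ω) (↑(box 3 b) : Set (Site 3)) x x') :
    ω ∈ {ω | ∃ u ∈ (box 3 b).filter (fun v => v 2 = -((a - 1 : ℕ) : ℤ)),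
      ∃ u' ∈ (box 3 b).filter (fun v => v 2 = ((a - 1 : ℕ) : ℤ)),
        ω ∈ openConnIn (↑((box 3 b).filter
          (fun v => -((a - 1 : ℕ) : ℤ) ≤ v 2 ∧ v 2 ≤ ((a - 1 : ℕ) : ℤ))) : Set (Site 3)) u u'} := by
  have hcast : ((a - 1 : ℕ) : ℤ) = (a : ℤ) - 1 := by omega
  -- first level crossing: down to the top layer `v₂ = a - 1`
  obtain ⟨w, hw2, hPw⟩ := FaceDecomposition.exists_levelPath_of_gt_of_ge hω hP 2 ((a : ℤ) - 1)
    (by omega) (by omega)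
  -- second level crossing: from `x'` up to the bottom layer `v₂ = -(a-1)`, read backwards
  obtain ⟨w', hw'2, hPw'⟩ := FaceDecomposition.exists_levelPath_of_lt_of_le hω hPw.symm 2 (-((a : ℤ) - 1))
    (by omega) (by omega)
  refine ⟨w', ?_, w, ?_, ?_⟩
  · rw [Finset.mem_filter]
    exact ⟨Finset.mem_coe.1 hPw'.left_mem.2.2, by rw [hcast, hw'2]⟩
  · rw [Finset.mem_filter]
    exact ⟨Finset.mem_coe.1 hPw'.right_mem.2.2, by rw [hcast, hw2]⟩
  · refine mem_openConnIn_of_pathIn (hPw'.mono fun v hv => ?_)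
    rw [coe_filter_eq]
    refine ⟨?_, hv.2.2⟩
    show -((a - 1 : ℕ) : ℤ) ≤ v 2 ∧ v 2 ≤ ((a - 1 : ℕ) : ℤ)
    rw [hcast]
    exact ⟨hv.1, hv.2.1⟩

/-- **`E₁ ∩ F⁺_fin ∩ F⁻_fin ⊆ A₂(a,b)`** on lattice configurations: the two finite plate arms are two
crossings of `(Λ(a), Λ(b))`, and they are NOT joined inside `Λ(b)` because a joining path would cross the
closed slab vertically. [cite: VandenbergVanengelenburg2022, proof of Prop. 2] -/
theorem subset_twoCluster {a b : ℕ} (ha : 1 ≤ a) {ω : BondConfig (Site 3)} (hω : ω ⊆ (zdGraph 3).edgeSet)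
    (hE : ω ∉ {ω | ∃ u ∈ (box 3 b).filter (fun v => v 2 = -((a - 1 : ℕ) : ℤ)),
      ∃ u' ∈ (box 3 b).filter (fun v => v 2 = ((a - 1 : ℕ) : ℤ)),
        ω ∈ openConnIn (↑((box 3 b).filter
          (fun v => -((a - 1 : ℕ) : ℤ) ≤ v 2 ∧ v 2 ≤ ((a - 1 : ℕ) : ℤ))) : Set (Site 3)) u u'})
    (hFp : ω ∈ {ω | ∃ x ∈ (box 3 b).filter (fun v => |v 0| ≤ (a : ℤ) ∧ |v 1| ≤ (a : ℤ) ∧ v 2 = (a : ℤ)),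
      ∃ y ∈ innerBoundary (zdGraph 3) (box 3 b),
        ω ∈ openConnIn (↑((box 3 b).filter (fun v => (a : ℤ) ≤ v 2)) : Set (Site 3)) x y})
    (hFm : ω ∈ {ω | ∃ x ∈ (box 3 b).filter (fun v => |v 0| ≤ (a : ℤ) ∧ |v 1| ≤ (a : ℤ) ∧ v 2 = -(a : ℤ)),
      ∃ y ∈ innerBoundary (zdGraph 3) (box 3 b),
        ω ∈ openConnIn (↑((box 3 b).filter (fun v => v 2 ≤ -(a : ℤ))) : Set (Site 3)) x y}) :
    ω ∈ {ω | ∃ x ∈ box 3 a, ∃ x' ∈ box 3 a, ∃ y ∈ innerBoundary (zdGraph 3) (box 3 b),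
      ∃ y' ∈ innerBoundary (zdGraph 3) (box 3 b),
        ω ∈ openConnIn (↑(box 3 b) : Set (Site 3)) x y ∧ ω ∈ openConnIn (↑(box 3 b) : Set (Site 3)) x' y' ∧
        ω ∉ openConnIn (↑(box 3 b) : Set (Site 3)) x x'} := by
  obtain ⟨x, hx, y, hy, hxy⟩ := hFp
  obtain ⟨x', hx', y', hy', hx'y'⟩ := hFm
  rw [Finset.mem_filter] at hx hx'
  have hsub1 : (↑((box 3 b).filter (fun v => (a : ℤ) ≤ v 2)) : Set (Site 3)) ⊆ ↑(box 3 b) :=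
    Finset.coe_subset.2 (Finset.filter_subset _ _)
  have hsub2 : (↑((box 3 b).filter (fun v => v 2 ≤ -(a : ℤ))) : Set (Site 3)) ⊆ ↑(box 3 b) :=
    Finset.coe_subset.2 (Finset.filter_subset _ _)
  refine ⟨x, mem_box_of_plate hx.2.1 hx.2.2.1 (Or.inl hx.2.2.2), x',
    mem_box_of_plate hx'.2.1 hx'.2.2.1 (Or.inr hx'.2.2.2), y, hy, y', hy',
    openConnIn_mono hsub1 _ _ hxy, openConnIn_mono hsub2 _ _ hx'y', fun hconn => hE ?_⟩
  exact slabCrossing_of_pathIn ha hω hx.2.2.2 hx'.2.2.2 (mem_openConnIn_iff_pathIn.1 hconn)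

/-! ## §4 Locality and independence -/

/-- Configurations agreeing on the pairs inside `S` agree on every `{x ⟷ y in S}`. -/
theorem openConnIn_congr_of_inter_eq {S : Finset (Site 3)} {ω ω' : BondConfig (Site 3)}
    (h : ω ∩ (↑S.sym2 : Set (Sym2 (Site 3))) = ω' ∩ ↑S.sym2) (x y : Site 3) :
    ω ∈ openConnIn (↑S : Set (Site 3)) x y ↔ ω' ∈ openConnIn (↑S : Set (Site 3)) x y :=
  (determinedBy_iff _ _).1
    (determinedBy_openConnIn (↑S : Set (Site 3)) x y (K := (↑S.sym2 : Set (Sym2 (Site 3))))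
      (by rw [Finset.coe_sym2])) ω ω' h

/-- The closed-barrier event `E₁ = V(b,h)ᶜ` is determined by the pairs inside the slab `Q`. -/
theorem determinedBy_barrier (b h : ℕ) :
    DeterminedBy {ω : BondConfig (Site 3) | ∃ u ∈ (box 3 b).filter (fun v => v 2 = -(h : ℤ)),
        ∃ u' ∈ (box 3 b).filter (fun v => v 2 = (h : ℤ)),
          ω ∈ openConnIn (↑((box 3 b).filter (fun v => -(h : ℤ) ≤ v 2 ∧ v 2 ≤ (h : ℤ))) : Set (Site 3)) u u'}ᶜ
      (↑((box 3 b).filter (fun v => -(h : ℤ) ≤ v 2 ∧ v 2 ≤ (h : ℤ))).sym2 : Set (Sym2 (Site 3))) := by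
  rw [determinedBy_iff]
  intro ω ω' hK
  simp only [Set.mem_compl_iff, Set.mem_setOf_eq, openConnIn_congr_of_inter_eq hK]

/-- The finite upper plate arm is determined by the pairs inside `Λ(b) ∩ {v₂ ≥ a}`. -/
theorem determinedBy_upper (a b : ℕ) :
    DeterminedBy {ω : BondConfig (Site 3) |
        ∃ x ∈ (box 3 b).filter (fun v => |v 0| ≤ (a : ℤ) ∧ |v 1| ≤ (a : ℤ) ∧ v 2 = (a : ℤ)),
          ∃ y ∈ innerBoundary (zdGraph 3) (box 3 b),
            ω ∈ openConnIn (↑((box 3 b).filter (fun v => (a : ℤ) ≤ v 2)) : Set (Site 3)) x y}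
      (↑((box 3 b).filter (fun v => (a : ℤ) ≤ v 2)).sym2 : Set (Sym2 (Site 3))) := by
  rw [determinedBy_iff]
  intro ω ω' hK
  simp only [Set.mem_setOf_eq, openConnIn_congr_of_inter_eq hK]

/-- The finite lower plate arm is determined by the pairs inside `Λ(b) ∩ {v₂ ≤ -a}`. -/
theorem determinedBy_lower (a b : ℕ) :
    DeterminedBy {ω : BondConfig (Site 3) |
        ∃ x ∈ (box 3 b).filter (fun v => |v 0| ≤ (a : ℤ) ∧ |v 1| ≤ (a : ℤ) ∧ v 2 = -(a : ℤ)),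
          ∃ y ∈ innerBoundary (zdGraph 3) (box 3 b),
            ω ∈ openConnIn (↑((box 3 b).filter (fun v => v 2 ≤ -(a : ℤ))) : Set (Site 3)) x y}
      (↑((box 3 b).filter (fun v => v 2 ≤ -(a : ℤ))).sym2 : Set (Sym2 (Site 3))) := by
  rw [determinedBy_iff]
  intro ω ω' hK
  simp only [Set.mem_setOf_eq, openConnIn_congr_of_inter_eq hK]

/-- The three vertex regions are pairwise disjoint (`h + 1 = a`, `a ≥ 1`): slab vs upper. -/
theorem disjoint_slab_upper {a : ℕ} (ha : 1 ≤ a) (b : ℕ) :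
    Disjoint ((box 3 b).filter (fun v => -((a - 1 : ℕ) : ℤ) ≤ v 2 ∧ v 2 ≤ ((a - 1 : ℕ) : ℤ)))
      ((box 3 b).filter (fun v => (a : ℤ) ≤ v 2)) := by
  rw [Finset.disjoint_filter]; intro v _ h1 h2; omega

/-- Slab vs lower. -/
theorem disjoint_slab_lower {a : ℕ} (ha : 1 ≤ a) (b : ℕ) :
    Disjoint ((box 3 b).filter (fun v => -((a - 1 : ℕ) : ℤ) ≤ v 2 ∧ v 2 ≤ ((a - 1 : ℕ) : ℤ)))
      ((box 3 b).filter (fun v => v 2 ≤ -(a : ℤ))) := by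
  rw [Finset.disjoint_filter]; intro v _ h1 h2; omega

/-- Upper vs lower. -/
theorem disjoint_upper_lower {a : ℕ} (ha : 1 ≤ a) (b : ℕ) :
    Disjoint ((box 3 b).filter (fun v => (a : ℤ) ≤ v 2)) ((box 3 b).filter (fun v => v 2 ≤ -(a : ℤ))) := by
  rw [Finset.disjoint_filter]; intro v _ h1 h2; omega

end BoundedAspectGeometry

open BoundedAspectGeometry in
/-- **Registered assembly inequality (vdBvE programme, part I):** for `1 ≤ a ≤ b`,
`(1 - P_p(V(b, a-1))) · P_p(F⁺(a,b))² ≤ P_p(A₂(a,b))` — the closed slab barrier (`E₁ = V ᶜ`) and the two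
plate arms are independent (disjoint supports after passing to the arms' first exits from `Λ(b)`), their
intersection lies in the two-cluster event, and `P(F⁻) = P(F⁺)` by reflection.
[cite: VandenbergVanengelenburg2022, proof of Prop. 2 (`P(A₂) ≥ P(E₁ ∩ F₂ ∩ F₃) ≥ ε* (ε')²`)] -/
theorem twoCluster_ge_barrier_mul_plate_sq (p : unitInterval) (a b : ℕ) (ha : 1 ≤ a) (hab : a ≤ b) :
    (1 - (bondPercolation (zdGraph 3) p).real
        {ω | ∃ x ∈ (box 3 b).filter (fun v => v 2 = -((a - 1 : ℕ) : ℤ)),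
          ∃ y ∈ (box 3 b).filter (fun v => v 2 = ((a - 1 : ℕ) : ℤ)),
            ω ∈ openConnIn (↑((box 3 b).filter
              (fun v => -((a - 1 : ℕ) : ℤ) ≤ v 2 ∧ v 2 ≤ ((a - 1 : ℕ) : ℤ))) : Set (Site 3)) x y}) *
      (bondPercolation (zdGraph 3) p).real
        {ω | ∃ x : Site 3, |x 0| ≤ (a : ℤ) ∧ |x 1| ≤ (a : ℤ) ∧ x 2 = (a : ℤ) ∧
          ∃ y : Site 3, y 2 = (b : ℤ) ∧ ω ∈ openConnIn {v : Site 3 | (a : ℤ) ≤ v 2} x y} ^ 2 ≤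
    (bondPercolation (zdGraph 3) p).real
      {ω | ∃ x ∈ box 3 a, ∃ x' ∈ box 3 a, ∃ y ∈ innerBoundary (zdGraph 3) (box 3 b),
        ∃ y' ∈ innerBoundary (zdGraph 3) (box 3 b),
          ω ∈ openConnIn (↑(box 3 b) : Set (Site 3)) x y ∧ ω ∈ openConnIn (↑(box 3 b) : Set (Site 3)) x' y' ∧
          ω ∉ openConnIn (↑(box 3 b) : Set (Site 3)) x x'} := by
  classical
  set P := bondPercolation (zdGraph 3) p with hP
  -- the three finite-volume events
  set V : Set (BondConfig (Site 3)) := {ω | ∃ x ∈ (box 3 b).filter (fun v => v 2 = -((a - 1 : ℕ) : ℤ)),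
      ∃ y ∈ (box 3 b).filter (fun v => v 2 = ((a - 1 : ℕ) : ℤ)),
        ω ∈ openConnIn (↑((box 3 b).filter
          (fun v => -((a - 1 : ℕ) : ℤ) ≤ v 2 ∧ v 2 ≤ ((a - 1 : ℕ) : ℤ))) : Set (Site 3)) x y} with hV
  set Fp : Set (BondConfig (Site 3)) := {ω |
      ∃ x ∈ (box 3 b).filter (fun v => |v 0| ≤ (a : ℤ) ∧ |v 1| ≤ (a : ℤ) ∧ v 2 = (a : ℤ)),
        ∃ y ∈ innerBoundary (zdGraph 3) (box 3 b),
          ω ∈ openConnIn (↑((box 3 b).filter (fun v => (a : ℤ) ≤ v 2)) : Set (Site 3)) x y} with hFp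
  set Fm : Set (BondConfig (Site 3)) := {ω |
      ∃ x ∈ (box 3 b).filter (fun v => |v 0| ≤ (a : ℤ) ∧ |v 1| ≤ (a : ℤ) ∧ v 2 = -(a : ℤ)),
        ∃ y ∈ innerBoundary (zdGraph 3) (box 3 b),
          ω ∈ openConnIn (↑((box 3 b).filter (fun v => v 2 ≤ -(a : ℤ))) : Set (Site 3)) x y} with hFm
  -- the two infinite-volume plate events and their shadows
  set Gp : Set (BondConfig (Site 3)) := {ω | ∃ x : Site 3, |x 0| ≤ (a : ℤ) ∧ |x 1| ≤ (a : ℤ) ∧ x 2 = (a : ℤ) ∧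
      ∃ y : Site 3, y 2 = (b : ℤ) ∧ ω ∈ openConnIn {v : Site 3 | (a : ℤ) ≤ v 2} x y} with hGp
  set Gm : Set (BondConfig (Site 3)) := {ω | ∃ x : Site 3, |x 0| ≤ (a : ℤ) ∧ |x 1| ≤ (a : ℤ) ∧ x 2 = -(a : ℤ) ∧
      ∃ y : Site 3, y 2 = -(b : ℤ) ∧ ω ∈ openConnIn {v : Site 3 | v 2 ≤ -(a : ℤ)} x y} with hGm
  have hGpFp : P.real Gp ≤ P.real Fp := by
    refine real_mono_of_forall_subset_edgeSet (zdGraph 3) p fun ω hω hG => ?_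
    obtain ⟨x, h0, h1, h2, y, hy, hxy⟩ := hG
    obtain ⟨w, hw, hxw⟩ := exists_exit_upper hab hω h0 h1 h2 hy hxy
    exact ⟨x, Finset.mem_filter.2 ⟨box_mono (d := 3) hab (mem_box_of_plate h0 h1 (Or.inl h2)), h0, h1, h2⟩,
      w, hw, hxw⟩
  have hGmFm : P.real Gm ≤ P.real Fm := by
    refine real_mono_of_forall_subset_edgeSet (zdGraph 3) p fun ω hω hG => ?_
    obtain ⟨x, h0, h1, h2, y, hy, hxy⟩ := hG
    obtain ⟨w, hw, hxw⟩ := exists_exit_lower hab hω h0 h1 h2 hy hxy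
    exact ⟨x, Finset.mem_filter.2 ⟨box_mono (d := 3) hab (mem_box_of_plate h0 h1 (Or.inr h2)), h0, h1, h2⟩,
      w, hw, hxw⟩
  have hGmGp : P.real Gm = P.real Gp := plate_reflection p a b
  -- independence of the three finite-volume events
  have hVdet := determinedBy_barrier b (a - 1)
  have hFpdet := determinedBy_upper a b
  have hFmdet := determinedBy_lower a b
  have hdisj1 := disjoint_sym2 (disjoint_upper_lower ha b)
  have hFF : P.real (Fp ∩ Fm) = P.real Fp * P.real Fm :=
    real_inter_of_determinedBy_disjoint (zdGraph 3) p hFpdet hFmdet hdisj1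
  have hFFdet : DeterminedBy (Fp ∩ Fm)
      (↑(((box 3 b).filter (fun v => (a : ℤ) ≤ v 2)).sym2 ∪ ((box 3 b).filter (fun v => v 2 ≤ -(a : ℤ))).sym2) :
        Set (Sym2 (Site 3))) := by
    rw [Finset.coe_union]
    exact (hFpdet.mono Set.subset_union_left).inter (hFmdet.mono Set.subset_union_right)
  have hdisj2 : Disjoint ((box 3 b).filter
        (fun v => -((a - 1 : ℕ) : ℤ) ≤ v 2 ∧ v 2 ≤ ((a - 1 : ℕ) : ℤ))).sym2
      (((box 3 b).filter (fun v => (a : ℤ) ≤ v 2)).sym2 ∪ ((box 3 b).filter (fun v => v 2 ≤ -(a : ℤ))).sym2) := by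
    rw [Finset.disjoint_union_right]
    exact ⟨disjoint_sym2 (disjoint_slab_upper ha b), disjoint_sym2 (disjoint_slab_lower ha b)⟩
  have hEFF : P.real (Vᶜ ∩ (Fp ∩ Fm)) = P.real Vᶜ * P.real (Fp ∩ Fm) :=
    real_inter_of_determinedBy_disjoint (zdGraph 3) p hVdet hFFdet hdisj2
  -- the complement of the barrier crossing
  have hVmeas : MeasurableSet V :=
    (DeterminedBy.measurableSet_of_finset (F := ((box 3 b).filter
      (fun v => -((a - 1 : ℕ) : ℤ) ≤ v 2 ∧ v 2 ≤ ((a - 1 : ℕ) : ℤ))).sym2)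
      (by
        rw [determinedBy_iff]
        intro ω ω' hK
        simp only [hV, Set.mem_setOf_eq, openConnIn_congr_of_inter_eq hK]))
  have hVc : P.real Vᶜ = 1 - P.real V := by
    rw [measureReal_compl hVmeas, probReal_univ]
  -- inclusion in the two-cluster event
  have hincl : P.real (Vᶜ ∩ (Fp ∩ Fm)) ≤ P.real
      {ω | ∃ x ∈ box 3 a, ∃ x' ∈ box 3 a, ∃ y ∈ innerBoundary (zdGraph 3) (box 3 b),
        ∃ y' ∈ innerBoundary (zdGraph 3) (box 3 b),
          ω ∈ openConnIn (↑(box 3 b) : Set (Site 3)) x y ∧ ω ∈ openConnIn (↑(box 3 b) : Set (Site 3)) x' y' ∧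
          ω ∉ openConnIn (↑(box 3 b) : Set (Site 3)) x x'} :=
    real_mono_of_forall_subset_edgeSet (zdGraph 3) p fun ω hω hmem =>
      subset_twoCluster ha hω hmem.1 hmem.2.1 hmem.2.2
  -- assembly
  have h0V : 0 ≤ 1 - P.real V := by rw [← hVc]; exact measureReal_nonneg
  calc (1 - P.real V) * P.real Gp ^ 2
      = (1 - P.real V) * (P.real Gp * P.real Gm) := by rw [hGmGp, sq]
    _ ≤ (1 - P.real V) * (P.real Fp * P.real Fm) :=
        mul_le_mul_of_nonneg_left (mul_le_mul hGpFp hGmFm measureReal_nonneg measureReal_nonneg) h0V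
    _ = P.real (Vᶜ ∩ (Fp ∩ Fm)) := by rw [hEFF, hFF, hVc]
    _ ≤ _ := hincl

end Summit.CriticalPhenomena.PercolationContinuityZ3.Theorems.NearLinearTwoClusterDecay.Negative

end
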